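import Summits.Ventures.PercRepro.Graph
import Summits.Ventures.PercRepro.Conjectures
import Summits.Ventures.PercRepro.StrongFKG

/-!
# C-004 (the pair-sum inequality) from Gladkov's strong Harris–Kleitman inequality

For three marked vertices `a, b, c` of a finite multigraph, label every configuration by the
partition of `{a, b, c}` it induces (`label3`: `0 = abc`, `1 = ab|c`, `2 = ac|b`, `3 = bc|a`,
`4 = a|b|c`). The classes `{0} ∪ {i}` (`i = 1, 2, 3`) are the connection events `{a~b}`, `{a~c}`,
`{b~c}` — increasing events — so `strong_harris_kleitman` with `a := 0`, `b := 4` gives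
`y₁y₂ + y₁y₃ + y₂y₃ ≤ x z`: the cell's candidate C-004 (`C004conn`, `C004`), which is
Gladkov's Corollary 4.2 (arXiv:2305.02653). This is the second, independent Lean route to C-004
(the first being the single-merge concavity principle of `proofs/P4-pairsum.md`).
-/

namespace PercRepro

open Finset

variable {V E : Type*} [Fintype E] [DecidableEq E]

namespace MultiGraph

variable (G : MultiGraph V E)

/-- The label of the partition of `{a, b, c}` induced by `ω`:
`0 = abc`, `1 = ab|c`, `2 = ac|b`, `3 = bc|a`, `4 = a|b|c`. -/
noncomputable def label3 (a b c : V) (ω : Config E) : Fin 5 :=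
  open scoped Classical in
  if G.Conn ω a b then (if G.Conn ω b c then 0 else 1)
  else (if G.Conn ω a c then 2 else if G.Conn ω b c then 3 else 4)

omit [Fintype E] [DecidableEq E] in
/-- `label3 = 0` iff `a ~ b ~ c`. -/
theorem label3_eq_zero_iff {a b c : V} {ω : Config E} :
    G.label3 a b c ω = 0 ↔ G.Conn ω a b ∧ G.Conn ω b c := by
  unfold label3
  split_ifs <;> simp_all

omit [Fintype E] [DecidableEq E] in
/-- `label3 = 1` iff `a ~ b` and `a ≁ c`. -/
theorem label3_eq_one_iff {a b c : V} {ω : Config E} :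
    G.label3 a b c ω = 1 ↔ G.Conn ω a b ∧ ¬ G.Conn ω a c := by
  unfold label3
  split_ifs with h1 h2 h3 h4
  · simp only [Fin.zero_eq_one_iff, OfNat.ofNat_ne_one, false_iff, not_and, not_not]
    intro _
    exact h1.trans h2
  · simp only [true_iff]
    exact ⟨h1, fun h => h2 (h1.symm.trans h)⟩
  · simp [h1]
  · simp [h1]
  · simp [h1]

omit [Fintype E] [DecidableEq E] in
/-- `label3 = 2` iff `a ~ c` and `a ≁ b`. -/
theorem label3_eq_two_iff {a b c : V} {ω : Config E} :
    G.label3 a b c ω = 2 ↔ G.Conn ω a c ∧ ¬ G.Conn ω a b := by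
  unfold label3
  split_ifs <;> simp_all

omit [Fintype E] [DecidableEq E] in
/-- `label3 = 3` iff `b ~ c` and `a ≁ b`. -/
theorem label3_eq_three_iff {a b c : V} {ω : Config E} :
    G.label3 a b c ω = 3 ↔ G.Conn ω b c ∧ ¬ G.Conn ω a b := by
  unfold label3
  split_ifs with h1 h2 h3 h4
  · simp [h1]
  · simp [h1]
  · simp only [Fin.reduceEq, false_iff, not_and, not_not]
    intro h
    exact absurd (h3.trans h.symm) h1
  · simp [h1, h4]
  · simp [h1, h4]

omit [Fintype E] [DecidableEq E] in
/-- `label3 = 4` iff the three marks are pairwise disconnected. -/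
theorem label3_eq_four_iff {a b c : V} {ω : Config E} :
    G.label3 a b c ω = 4 ↔ ¬ G.Conn ω a b ∧ ¬ G.Conn ω a c ∧ ¬ G.Conn ω b c := by
  unfold label3
  split_ifs <;> simp_all

omit [Fintype E] [DecidableEq E] in
/-- The fibres of `label3` are the five partition events of `C004conn`. -/
theorem label3_preimage_zero (a b c : V) :
    G.label3 a b c ⁻¹' {0} = G.connEvent a b ∩ G.connEvent b c := by
  ext ω
  simp [label3_eq_zero_iff]

omit [Fintype E] [DecidableEq E] in
/-- The fibre `{label3 = 1}` as an event. -/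
theorem label3_preimage_one (a b c : V) :
    G.label3 a b c ⁻¹' {1} = G.connEvent a b ∩ G.sepEvent a c := by
  ext ω
  simp [label3_eq_one_iff]

omit [Fintype E] [DecidableEq E] in
/-- The fibre `{label3 = 2}` as an event. -/
theorem label3_preimage_two (a b c : V) :
    G.label3 a b c ⁻¹' {2} = G.connEvent a c ∩ G.sepEvent a b := by
  ext ω
  simp [label3_eq_two_iff]

omit [Fintype E] [DecidableEq E] in
/-- The fibre `{label3 = 3}` as an event. -/
theorem label3_preimage_three (a b c : V) :
    G.label3 a b c ⁻¹' {3} = G.connEvent b c ∩ G.sepEvent a b := by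
  ext ω
  simp [label3_eq_three_iff]

omit [Fintype E] [DecidableEq E] in
/-- The fibre `{label3 = 4}` as an event. -/
theorem label3_preimage_four (a b c : V) :
    G.label3 a b c ⁻¹' {4} = G.sepEvent a b ∩ G.sepEvent a c ∩ G.sepEvent b c := by
  ext ω
  simp [label3_eq_four_iff, and_assoc]

omit [Fintype E] [DecidableEq E] in
/-- The sunflower classes `{0} ∪ {i}` are the three connection events. -/
theorem label3_zero_or_one (a b c : V) :
    {ω | G.label3 a b c ω = 0 ∨ G.label3 a b c ω = 1} = G.connEvent a b := by
  ext ω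
  simp only [Set.mem_setOf_eq, label3_eq_zero_iff, label3_eq_one_iff, mem_connEvent]
  constructor
  · rintro (⟨h, -⟩ | ⟨h, -⟩) <;> exact h
  · intro h
    by_cases hbc : G.Conn ω b c
    · exact Or.inl ⟨h, hbc⟩
    · exact Or.inr ⟨h, fun hac => hbc (h.symm.trans hac)⟩

omit [Fintype E] [DecidableEq E] in
/-- `{label3 ∈ {0, 2}}` is the connection event `a ~ c`. -/
theorem label3_zero_or_two (a b c : V) :
    {ω | G.label3 a b c ω = 0 ∨ G.label3 a b c ω = 2} = G.connEvent a c := by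
  ext ω
  simp only [Set.mem_setOf_eq, label3_eq_zero_iff, label3_eq_two_iff, mem_connEvent]
  constructor
  · rintro (⟨h1, h2⟩ | ⟨h, -⟩)
    · exact h1.trans h2
    · exact h
  · intro h
    by_cases hab : G.Conn ω a b
    · exact Or.inl ⟨hab, hab.symm.trans h⟩
    · exact Or.inr ⟨h, hab⟩

omit [Fintype E] [DecidableEq E] in
/-- `{label3 ∈ {0, 3}}` is the connection event `b ~ c`. -/
theorem label3_zero_or_three (a b c : V) :
    {ω | G.label3 a b c ω = 0 ∨ G.label3 a b c ω = 3} = G.connEvent b c := by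
  ext ω
  simp only [Set.mem_setOf_eq, label3_eq_zero_iff, label3_eq_three_iff, mem_connEvent]
  constructor
  · rintro (⟨-, h⟩ | ⟨h, -⟩) <;> exact h
  · intro h
    by_cases hab : G.Conn ω a b
    · exact Or.inl ⟨hab, h⟩
    · exact Or.inr ⟨h, hab⟩

end MultiGraph

/-- The middle labels between `0` and `4` in `Fin 5` are `{1, 2, 3}`. -/
theorem StrongFKG.mid_zero_four : StrongFKG.mid (0 : Fin 5) 4 = {1, 2, 3} := by
  decide

/-- **C-004 from the strong Harris–Kleitman inequality**: for any three vertices `a, b, c`,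
`P(ab|c)·P(ac|b) + P(ab|c)·P(bc|a) + P(ac|b)·P(bc|a) ≤ P(abc)·P(a|b|c)`, in the connection-event
form of `C004conn`. -/
theorem pairSum_of_strongHarrisKleitman (G : MultiGraph V E) {p : E → ℝ} (hp : IsProb p)
    (a b c : V) :
    prob p (G.connEvent a b ∩ G.sepEvent a c) * prob p (G.connEvent a c ∩ G.sepEvent a b) +
        prob p (G.connEvent a b ∩ G.sepEvent a c) * prob p (G.connEvent b c ∩ G.sepEvent a b) +
        prob p (G.connEvent a c ∩ G.sepEvent a b) * prob p (G.connEvent b c ∩ G.sepEvent a b) ≤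
      prob p (G.connEvent a b ∩ G.connEvent b c) *
        prob p (G.sepEvent a b ∩ G.sepEvent a c ∩ G.sepEvent b c) := by
  have hup : ∀ i ∈ StrongFKG.mid (0 : Fin 5) 4,
      IsUpperSet {ω | G.label3 a b c ω = 0 ∨ G.label3 a b c ω = i} := by
    intro i hi
    rw [StrongFKG.mid_zero_four] at hi
    simp only [Finset.mem_insert, Finset.mem_singleton] at hi
    rcases hi with rfl | rfl | rfl
    · rw [G.label3_zero_or_one]
      exact G.isUpperSet_connEvent a b
    · rw [G.label3_zero_or_two]
      exact G.isUpperSet_connEvent a c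
    · rw [G.label3_zero_or_three]
      exact G.isUpperSet_connEvent b c
  have h := strong_harris_kleitman (G.label3 a b c) (a := 0) (b := 4) (by decide) hup hp
  rw [StrongFKG.mid_zero_four, Finset.sum_insert (by decide), Finset.sum_insert (by decide),
    Finset.sum_singleton, Finset.sum_insert (by decide), Finset.sum_insert (by decide),
    Finset.sum_singleton, G.label3_preimage_zero, G.label3_preimage_one, G.label3_preimage_two,
    G.label3_preimage_three, G.label3_preimage_four] at h
  nlinarith [h]

/-- `C004conn` (typer-2's connection-event form of C-004) holds. -/
theorem C004conn_of_strongHarrisKleitman : C004conn :=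
  fun G _ hp a b c _ => pairSum_of_strongHarrisKleitman G hp a b c

/-- `C004` (the engine-row form of C-004) holds. -/
theorem C004_of_strongHarrisKleitman : C004 :=
  C004_iff_C004conn.2 C004conn_of_strongHarrisKleitman

end PercRepro
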